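import Summits.BirchSwinnertonDyer.BirchSwinnertonDyer.Theorems.RamifiedHeegnerPairLeafPartnerGenusLabelB4
import Summits.BirchSwinnertonDyer.BirchSwinnertonDyer.Theorems.AdditiveBranchIMCGenusKolyvaginTwistCongruence
import Literature.NumberTheory.EllipticCurves.GeomReductionFrobeniusProofs
import HarnessLib

/-!
# Crux U₁ `LeafRankOneUpperAtThree` (stmt-BirchSwinnertonDyer-26022) ∕ U₀ (26024), line `partnerdescent` — partner kernel part 20:
# the genus transport `ψ_Θ` over `ℚ̄` and REDUCTION at a good prime `ℓ ≠ 3` — the (B5) core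

HONEST FRAMING (lead prover `bsd-line-rhp-p2` g58, explicit-unit seat, cell `bsd-wall`): a SUPPORT file (`--supports 26022 --as helper`)
for the registered stub (DISPLAY-L) `stub_partnerGenusDisplayLabelledAtThree`. It proves NO stub and closes NO item; BSD is proved for no
curve. Theorems only; no definition, no named fact, no `sorry`.

WHAT. The label (B5) of `ShimuraWalk.LabelsAt` (Gross Prop. 3.7 (2): `red ys(m) = Frob_ℓ · red ys(m/ℓ)↑` above an inert `ℓ`) is stated
in the tree's reduction currency `geomReduction hΔ : W(ℚ̄) →+ W̃(𝔽̄_ℓ)` along the place `placeOver ℓ`. The fact's (B5′) gives it for the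
`V`-points; the descended `W`-family is `ψ_θ`(differences of `V`-points). This file transports a Frobenius congruence of reductions
through `ψ_Θ : V(ℚ̄) ≃+ W(ℚ̄)` (`Θ ∈ ℚ̄`, `Θ² = −3`), UNIFORMLY IN `ℓ ≠ 3` (in particular at `ℓ = 2`, where the completed-square
substitution is not `2`-integral and the coordinate proof of the `X₀(N)` genus line — `GenusKolyvagin.frobCongruentModPlace_twist`, odd `ℓ`,
direction base → twist — is not available; our direction is twist → base):
* §1 `smul_sqrt_negThree_of_isArithFrobAt` — an arithmetic Frobenius `σ ∈ Γ_ℚ` at the prime of the place over `ℓ ≠ 3` moves a root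
  `Θ` of `−3` by the sign `χ₋₃(ℓ)` (`+1` if `ℓ ≡ 1 (mod 3)`, `−1` otherwise): `ω = (Θ − 1)/2` is a unit root of `X² + X + 1`
  (`Valuation.le_one_of_quadratic`), `σω ≡ ω^ℓ = ω^{ℓ mod 3}`, and `ω − ω²` is a unit (`(ω − ω²)² = −3`).
* §2 `geomReduction_genusTransport_eq_zero` — `ψ_Θ` maps the kernel of reduction of `V` into that of `W`: `ψ_Θ⁻¹` is ONE substitution
  `T_Θ = CV ∘ ι_Θ⁻¹ ∘ C₁` between the two `𝒪`-integral minimal models with unit discriminants (`GenusKolyvagin.twistChange_smul`,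
  `twist_some`), so `|u| = 1`, `|r| ≤ 1` (Silverman VII.1.3 (b): `VariableChange.v_r_le_one_of_isIntegral`) and `|x| > 1 ⟺ |T.toX x| > 1`
  (`VariableChange.one_lt_v_toX_iff`).
* §3 `geomReduction_genusTransport_eq_of_eq` — **`red_V Q = φ₀ • red_V Q₀ ⟹ red_W(ψ_Θ Q) = χ₋₃(ℓ) • φ₀ • red_W(ψ_Θ Q₀)`**: with `σ` as
  in §1, `red_V(Q − σQ₀) = 0` (`geomReduction_smul_of_isArithFrobAt`), §2, `σ(ψ_Θ Q₀) = ψ_{σΘ}(σQ₀)` (`genusTransport_map_of_eq`) and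
  `ψ_{−Θ} = −ψ_Θ` (`genusTransport_map_of_eq_neg`). This sign `χ₋₃(ℓ)` is the one the re-signing `c_m = χ₋₃(ℓ) c_{m/ℓ}` removes.
Typed ≠ proved for the stub; BSD is proved for no curve.
[cite: GrossLMS1991, §3 Prop. 3.7 (2) (p. 237)] [cite: Nekovar2007, (4.9) (p. 571)] [cite: SilvermanAEC2009, VII.1 Prop. 1.3 (b), VII.2 Prop. 2.1,
X.5 Cor. 5.4 (iii)] [cite: Serre1972, §1.11] presearch: as parts 14–19 (bsd-addord `GenusKolyvagin.label_B5_level` is the X₀(N), odd-ℓ, base→twist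
analogue; nothing restated).
-/

noncomputable section

set_option linter.dupNamespace false
set_option autoImplicit false

open scoped Classical NumberField Pointwise

namespace Summit.BirchSwinnertonDyer.BirchSwinnertonDyer.Theorems.LeafPartnerGenusReduction

open WeierstrassCurve Literature.NumberTheory.EllipticCurves Literature.NumberTheory.GaloisRepresentations
  Summit.BirchSwinnertonDyer.BirchSwinnertonDyer.Theorems.LeafPartnerGenusTransport IsDedekindDomain Field NumberField
  Rat.HeightOneSpectrum

/-! ## §1 The Frobenius sign on `√−3` -/

/-- **An arithmetic Frobenius at a prime over `ℓ ≠ 3` moves `√−3` by `χ₋₃(ℓ)`**: for `σ ∈ Γ_ℚ` with `IsArithFrobAt` at the prime `𝔓` of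
`ℤ̄` cut out by `placeOver ℓ` and `Θ ∈ ℚ̄` with `Θ² = −3`: `σΘ = Θ` if `ℓ ≡ 1 (mod 3)` and `σΘ = −Θ` otherwise (`ℓ = 2` included). Proof
with `ω = (Θ − 1)/2`: `ω² + ω + 1 = 0`, `ω` lies in the place (`Valuation.le_one_of_quadratic`), `σω ≡ ω^ℓ = ω^{ℓ mod 3} (mod 𝔓)`
(`valuation_smul_sub_pow_lt_one_of_isArithFrobAt`), `σω ∈ {ω, ω²}`, and `ω − ω²` is a `𝔓`-unit since `(ω − ω²)² = −3`.
[cite: Serre1972, §1.11] [cite: SerreLocalFields1979, Ch. I §8] -/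
theorem smul_sqrt_negThree_of_isArithFrobAt {ℓ : ℕ} [Fact ℓ.Prime] (hℓ3 : ℓ ≠ 3)
    {𝔓 : Ideal (absIntegers (𝓞 ℚ) ℚ)}
    (hmem : ∀ x : absIntegers (𝓞 ℚ) ℚ, x ∈ 𝔓 ↔ (x : AlgebraicClosure ℚ) ∈ (placeOver ℓ).nonunits)
    {v : HeightOneSpectrum (𝓞 ℚ)} (hv : (primesEquiv v : ℕ) = ℓ) (h𝔓 : 𝔓 ∈ v.primesAbove)
    {σ : absoluteGaloisGroup ℚ} (hσ : IsArithFrobAt (𝓞 ℚ) σ 𝔓)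
    {Θ : AlgebraicClosure ℚ} (hΘ : Θ ^ 2 = -3) :
    σ • Θ = if ℓ % 3 = 1 then Θ else -Θ := by
  have hℓ : ℓ.Prime := Fact.out
  set w := (placeOver ℓ).valuation with hw
  have hℓO : ((ℓ : ℕ) : AlgebraicClosure ℚ) ∈ (placeOver ℓ).nonunits :=
    (ValuationSubring.mem_nonunits_iff _).mpr (valuation_placeOver_natCast_lt_one ℓ)
  -- `ω = (Θ − 1)/2`, a root of `X² + X + 1`
  obtain ⟨ω, hωdef⟩ : ∃ ω : AlgebraicClosure ℚ, ω = (Θ - 1) / 2 := ⟨_, rfl⟩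
  have hΘω : Θ = 2 * ω + 1 := by rw [hωdef]; field_simp; ring
  have hω : ω ^ 2 + 1 * ω + 1 = 0 := by
    rw [hΘω] at hΘ; linear_combination hΘ / 4
  have hω3 : ω ^ 3 = 1 := by linear_combination (ω - 1) * hω
  have hωsq : ω ^ 2 = -ω - 1 := by linear_combination hω
  have h2σ : σ • (2 : AlgebraicClosure ℚ) = 2 := by
    rw [Field.absoluteGaloisGroup.smul_def]; exact map_ofNat _ 2
  -- `ω` lies in the place
  have hωO : ω ∈ placeOver ℓ := ((placeOver ℓ).valuation_le_one_iff ω).mp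
    (Valuation.le_one_of_quadratic w hω (by rw [map_one]) (by rw [map_one]))
  -- `ω − ω²` is a unit: `(ω − ω²)² = −3`
  have hunit : w (ω - ω ^ 2) = 1 := by
    have hsq : (ω - ω ^ 2) ^ 2 = ((-3 : ℤ) : AlgebraicClosure ℚ) := by
      push_cast; linear_combination (ω ^ 2 - 3 * ω + 3) * hω
    have h3 : w (((-3 : ℤ) : AlgebraicClosure ℚ)) = 1 :=
      GenusKolyvagin.valuation_intCast_eq_one (placeOver ℓ) hℓ hℓO (fun h => hℓ3
        ((Nat.prime_dvd_prime_iff_eq hℓ Nat.prime_three).mp (by exact_mod_cast (dvd_neg.mp h))))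
    rw [← hsq, map_pow] at h3
    rcases pow_eq_one_iff.mp h3 with h | h
    · exact h
    · exact absurd h two_ne_zero
  -- `σω ≡ ω^ℓ (mod 𝔓)` and `σω ∈ {ω, ω²}`
  have hcong := valuation_smul_sub_pow_lt_one_of_isArithFrobAt hmem hv h𝔓 hσ hωO
  have hσω : σ • ω = ω ∨ σ • ω = ω ^ 2 := by
    have h0 : (σ • ω) ^ 2 + 1 * (σ • ω) + 1 = 0 := by
      have := congrArg (fun z : AlgebraicClosure ℚ => σ • z) hω
      simp only [smul_add, smul_pow', smul_one, smul_zero, one_mul] at this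
      rw [one_mul]; exact this
    have hprod : (σ • ω - ω) * (σ • ω - ω ^ 2) = 0 := by
      linear_combination h0 - (σ • ω) * hω + hω3
    rcases mul_eq_zero.mp hprod with h | h
    · exact Or.inl (sub_eq_zero.mp h)
    · exact Or.inr (sub_eq_zero.mp h)
  -- `ω^ℓ = ω^{ℓ mod 3}`
  have hpow : ω ^ ℓ = ω ^ (ℓ % 3) := by
    conv_lhs => rw [← Nat.div_add_mod ℓ 3, pow_add, pow_mul, hω3, one_pow, one_mul]
  have hmod : ℓ % 3 = 1 ∨ ℓ % 3 = 2 := by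
    have h3 : ¬ 3 ∣ ℓ := fun h => hℓ3 ((Nat.prime_dvd_prime_iff_eq Nat.prime_three hℓ).mp h).symm
    omega
  have hσΘ : σ • Θ = 2 * σ • ω + 1 := by
    rw [hΘω, smul_add, smul_mul', h2σ, smul_one]
  rcases hmod with h1 | h2
  · -- `ℓ ≡ 1 (mod 3)`: `σω = ω`
    rw [if_pos h1]
    rw [hpow, h1, pow_one] at hcong
    rcases hσω with h | h
    · rw [hσΘ, h, hΘω]
    · exfalso
      rw [h, ← Valuation.map_neg, neg_sub] at hcong
      exact (lt_irrefl _) (hunit ▸ hcong)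
  · -- `ℓ ≡ 2 (mod 3)`: `σω = ω²`
    rw [if_neg (by omega)]
    rw [hpow, h2] at hcong
    rcases hσω with h | h
    · exfalso
      rw [h] at hcong
      exact (lt_irrefl _) (hunit ▸ hcong)
    · rw [hσΘ, h, hΘω, hωsq]; ring

/-! ## §2 `ψ_Θ` preserves the kernels of reduction -/

/-- **The kernel of reduction in coordinates** (Silverman VII.2.1): `red(x, y) = Õ` iff `v_𝔓(x) > 1`. [cite: SilvermanAEC2009, VII.2 Prop. 2.1] -/
theorem geomReduction_some_eq_zero_iff' {W : WeierstrassCurve ℚ} [W.IsGloballyMinimal] {p : ℕ} [Fact p.Prime]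
    (hΔ : ¬ (p : ℤ) ∣ minimalDiscriminantInt W)
    {x y : AlgebraicClosure ℚ} (h : (W.baseChange (AlgebraicClosure ℚ)).toAffine.Nonsingular x y) :
    geomReduction hΔ (.some x y h) = 0 ↔ 1 < (placeOver p).valuation x := by
  rw [geomReduction_eq_zero_iff, Affine.Point.congrEquiv_some, WeierstrassCurve.reducesToZero_some_iff]
  exact not_mem_range_iff (integers_placeOver p)

section Transport

variable (W : WeierstrassCurve ℚ) {W₁ : WeierstrassCurve ℚ} [W₁.IsCharNeTwoNF] (C₁ : VariableChange ℚ) (hC₁ : C₁ • W = W₁)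
  {V : WeierstrassCurve ℚ} (CV : VariableChange ℚ) (hV : CV • W₁.quadraticTwist (-3) = V)

set_option maxHeartbeats 800000 in -- the defeq `((-3 : ℤ) : ℚ) = -3` inside the types of the template lemmas
/-- **`ψ_Θ` maps the kernel of reduction of `V` into that of `W`** at every prime `ℓ` of good reduction for both (`ℓ = 2` included):
`ψ_Θ⁻¹ = T_Θ = CV ∘ ι_Θ⁻¹ ∘ C₁` is one substitution between the `𝒪_𝔓`-integral minimal models `W_{ℚ̄}`, `V_{ℚ̄}` with unit discriminants,
so `|u(T_Θ)| = 1` and `|r(T_Θ)| ≤ 1` (Silverman VII.1.3 (b)) and `|x(P)| > 1 ⟺ |x(T_Θ P)| > 1`. [cite: SilvermanAEC2009, VII.1 Prop. 1.3 (b), VII.2 Prop. 2.1] -/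
theorem geomReduction_genusTransport_eq_zero [W.IsGloballyMinimal] [V.IsGloballyMinimal]
    {ℓ : ℕ} [Fact ℓ.Prime] (hΔW : ¬ (ℓ : ℤ) ∣ minimalDiscriminantInt W) (hΔV : ¬ (ℓ : ℤ) ∣ minimalDiscriminantInt V)
    {Θ : AlgebraicClosure ℚ} (hΘ : Θ ^ 2 = algebraMap ℚ (AlgebraicClosure ℚ) (-3))
    {Q : V.geomPoints} (hQ : geomReduction hΔV Q = 0) :
    geomReduction hΔW (genusTransport W C₁ hC₁ CV hV hΘ Q) = 0 := by
  subst hV hC₁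
  have hℓ : ℓ.Prime := Fact.out
  have hℓO : ((ℓ : ℕ) : AlgebraicClosure ℚ) ∈ (placeOver ℓ).nonunits :=
    (ValuationSubring.mem_nonunits_iff _).mpr (valuation_placeOver_natCast_lt_one ℓ)
  have hΘ0 : Θ ≠ 0 := theta_ne_zero hΘ
  have hΘ' : Θ ^ 2 = algebraMap ℚ (AlgebraicClosure ℚ) ((-3 : ℤ) : ℚ) := by
    rw [show ((-3 : ℤ) : ℚ) = -3 by norm_num]; exact hΘ
  -- the substitution `T_Θ = CV ∘ ι_Θ⁻¹ ∘ C₁` and its integrality at the place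
  set T : VariableChange (AlgebraicClosure ℚ) :=
    CV.map (algebraMap ℚ (AlgebraicClosure ℚ)) * ((untwistAt hΘ0)⁻¹ * C₁.map (algebraMap ℚ (AlgebraicClosure ℚ))) with hTdef
  have hTs : T • W.baseChange (AlgebraicClosure ℚ) = (CV • (C₁ • W).quadraticTwist (-3)).baseChange (AlgebraicClosure ℚ) :=
    GenusKolyvagin.twistChange_smul W C₁ CV (-3) hΘ' hΘ0
  have hVal : ∀ x : AlgebraicClosure ℚ, (placeOver ℓ).valuation x ≤ 1 ↔
      x ∈ (algebraMap (placeOver ℓ) (AlgebraicClosure ℚ)).range := fun x => by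
    rw [(placeOver ℓ).valuation_le_one_iff]
    exact ⟨fun hx => ⟨⟨x, hx⟩, rfl⟩, fun ⟨y, hy⟩ => hy ▸ y.2⟩
  haveI : (W.baseChange (AlgebraicClosure ℚ)).IsIntegral (placeOver ℓ) :=
    GenusKolyvagin.isIntegral_baseChange_of_isGloballyMinimal (placeOver ℓ) W
  haveI : (T • W.baseChange (AlgebraicClosure ℚ)).IsIntegral (placeOver ℓ) := by
    rw [hTs]; exact GenusKolyvagin.isIntegral_baseChange_of_isGloballyMinimal (placeOver ℓ) _
  have hu : (placeOver ℓ).valuation (T.u : AlgebraicClosure ℚ) = 1 := by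
    have hΔ := (W.baseChange (AlgebraicClosure ℚ)).variableChange_Δ T
    rw [hTs, GenusKolyvagin.Δ_baseChange_eq_intCast, GenusKolyvagin.Δ_baseChange_eq_intCast] at hΔ
    have h1 := GenusKolyvagin.valuation_intCast_eq_one (placeOver ℓ) hℓ hℓO hΔV
    rw [hΔ, map_mul, map_pow, GenusKolyvagin.valuation_intCast_eq_one (placeOver ℓ) hℓ hℓO hΔW, mul_one,
      Units.val_inv_eq_inv_val, map_inv₀] at h1
    have h2 : ((placeOver ℓ).valuation (T.u : AlgebraicClosure ℚ))⁻¹ = 1 := by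
      rcases pow_eq_one_iff.mp h1 with h | h
      · exact h
      · norm_num at h
    exact inv_eq_one.mp h2
  have hr : (placeOver ℓ).valuation T.r ≤ 1 :=
    VariableChange.v_r_le_one_of_isIntegral hVal (W.baseChange (AlgebraicClosure ℚ)) T hu
  -- case analysis on `ψ_Θ Q`
  rcases hP : genusTransport W C₁ rfl CV rfl hΘ Q with _ | ⟨x, y, hxy⟩
  · exact map_zero _
  · have hQ' : Q = (genusTransport W C₁ rfl CV rfl hΘ).symm (.some x y hxy) := by
      rw [← hP, AddEquiv.symm_apply_apply]
    obtain ⟨h', e'⟩ := GenusKolyvagin.twist_some W C₁ CV (-3) hΘ' hΘ0 hxy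
    have hQ'' : Q = .some (T.toX x) (T.toY x y) h' := by rw [hQ']; exact e'
    rw [hQ'', geomReduction_some_eq_zero_iff' hΔV] at hQ
    exact (geomReduction_some_eq_zero_iff' hΔW hxy).mpr ((VariableChange.one_lt_v_toX_iff T hu hr x).mp hQ)

/-! ## §3 The transport of a Frobenius congruence of reductions -/

/-- **THE (B5) CORE — a Frobenius congruence of reductions passes through `ψ_Θ` with the sign `χ₋₃(ℓ)`.** `W`, `V = CV • (C₁ • W)^{(−3)}`
globally minimal, `ℓ ≠ 3` a prime of good reduction for both (`ℓ = 2` allowed), `red_X = geomReduction : X(ℚ̄) → X̃(𝔽̄_ℓ)` along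
`placeOver ℓ`, `φ₀` the `ℓ`-Frobenius, `Θ ∈ ℚ̄`, `Θ² = −3`. If `red_V Q = φ₀ • red_V Q₀` then
`red_W(ψ_Θ Q) = χ • φ₀ • red_W(ψ_Θ Q₀)` with `χ = 1` if `ℓ ≡ 1 (mod 3)` and `χ = −1` otherwise. Proof: `σ ∈ Γ_ℚ` an arithmetic
Frobenius at the place (`exists_isArithFrobAt_placeOver`); `red_V(σQ₀) = φ₀ • red_V Q₀` (`geomReduction_smul_of_isArithFrobAt`), so
`Q − σQ₀` reduces to `Õ`, hence so does `ψ_Θ(Q − σQ₀)` (§2); `σ(ψ_Θ Q₀) = ψ_{σΘ}(σQ₀)` (`genusTransport_map_of_eq`) and `σΘ = χΘ` (§1).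
[cite: GrossLMS1991, §3 Prop. 3.7 (2)] [cite: Serre1972, §1.11] [cite: SilvermanAEC2009, VII.2 Prop. 2.1, X.5 Cor. 5.4 (iii)] -/
theorem geomReduction_genusTransport_eq_of_eq [W.IsElliptic] [W.IsGloballyMinimal] [V.IsElliptic] [V.IsGloballyMinimal]
    {ℓ : ℕ} [Fact ℓ.Prime] (hℓ3 : ℓ ≠ 3)
    (hΔW : ¬ (ℓ : ℤ) ∣ minimalDiscriminantInt W) (hΔV : ¬ (ℓ : ℤ) ∣ minimalDiscriminantInt V)
    {φ₀ : absoluteGaloisGroup (ZMod ℓ)} (hφ₀ : ∀ x : AlgebraicClosure (ZMod ℓ), φ₀ • x = x ^ ℓ)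
    {Θ : AlgebraicClosure ℚ} (hΘ : Θ ^ 2 = algebraMap ℚ (AlgebraicClosure ℚ) (-3))
    {Q Q₀ : V.geomPoints} (h : geomReduction hΔV Q = φ₀ • geomReduction hΔV Q₀) :
    geomReduction hΔW (genusTransport W C₁ hC₁ CV hV hΘ Q) =
      (if ℓ % 3 = 1 then (1 : ℤ) else -1) • φ₀ • geomReduction hΔW (genusTransport W C₁ hC₁ CV hV hΘ Q₀) := by
  obtain ⟨v, 𝔓, σ, hv, hmem, h𝔓, hσ⟩ := exists_isArithFrobAt_placeOver ℓ
  have hΘ3 : Θ ^ 2 = -3 := by rw [hΘ, map_neg, map_ofNat]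
  -- `Q − σQ₀` reduces to `Õ`, hence so does its `ψ`-image
  have hσQ₀ : geomReduction hΔV (σ • Q₀) = φ₀ • geomReduction hΔV Q₀ :=
    geomReduction_smul_of_isArithFrobAt hΔV hmem hv h𝔓 hσ hφ₀ Q₀
  have hker : geomReduction hΔV (Q - σ • Q₀) = 0 := by rw [map_sub, h, hσQ₀, sub_self]
  have hkerW := geomReduction_genusTransport_eq_zero W C₁ hC₁ CV hV hΔW hΔV hΘ hker
  have e1 : genusTransport W C₁ hC₁ CV hV hΘ (Q - σ • Q₀) =
      genusTransport W C₁ hC₁ CV hV hΘ Q - genusTransport W C₁ hC₁ CV hV hΘ (σ • Q₀) := map_sub _ _ _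
  rw [e1] at hkerW
  have e2 : geomReduction hΔW (genusTransport W C₁ hC₁ CV hV hΘ Q - genusTransport W C₁ hC₁ CV hV hΘ (σ • Q₀)) =
      geomReduction hΔW (genusTransport W C₁ hC₁ CV hV hΘ Q) -
        geomReduction hΔW (genusTransport W C₁ hC₁ CV hV hΘ (σ • Q₀)) := map_sub _ _ _
  rw [e2, sub_eq_zero] at hkerW
  rw [hkerW]
  -- the Frobenius on the `W`-side and the equivariance of `ψ`
  obtain ⟨P₀, hP₀⟩ : ∃ P₀ : W.geomPoints, P₀ = genusTransport W C₁ hC₁ CV hV hΘ Q₀ := ⟨_, rfl⟩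
  have hred : geomReduction hΔW (σ • P₀) = φ₀ • geomReduction hΔW P₀ :=
    geomReduction_smul_of_isArithFrobAt hΔW hmem hv h𝔓 hσ hφ₀ P₀
  have hsign := smul_sqrt_negThree_of_isArithFrobAt hℓ3 hmem hv h𝔓 hσ hΘ3
  rw [← hP₀]
  split_ifs with h1
  · rw [if_pos h1] at hsign
    have hequiv : σ • P₀ = genusTransport W C₁ hC₁ CV hV hΘ (σ • Q₀) := by
      rw [hP₀]
      exact genusTransport_map_of_eq W C₁ hC₁ CV hV hΘ hΘ
        (Field.absoluteGaloisGroup.toAlgEquiv ℚ σ).toAlgHom hsign Q₀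
    rw [one_smul, ← hred, hequiv]
  · rw [if_neg h1] at hsign
    have hequiv : -(σ • P₀) = genusTransport W C₁ hC₁ CV hV hΘ (σ • Q₀) := by
      rw [neg_eq_iff_eq_neg, hP₀]
      exact genusTransport_map_of_eq_neg W C₁ hC₁ CV hV hΘ hΘ
        (Field.absoluteGaloisGroup.toAlgEquiv ℚ σ).toAlgHom hsign Q₀
    rw [neg_one_zsmul, ← hred, ← map_neg, hequiv]

end Transport

end Summit.BirchSwinnertonDyer.BirchSwinnertonDyer.Theorems.LeafPartnerGenusReduction

end
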